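import Summits.AtomisticToContinuum.Crystallization.Theorems.ChargedEnergyGapChartDialI

/-!
# `ChargedEnergyGap` · the CHART DIAL, part J: CLEAN APPROACH — decomp-a2c lens-3 g38 node «ScaleCoherence», the residual cut to what the assembly uses

Part I asked chain no-zoom in CLEAN balls for EVERY site a charted chain reaches inside the ball (`CleanBallHarnack θ R M₀ M₁`).  Its
Möbius lower bound is governed by the ball's DIAMETER: `M₀ ≥ (N(θ)/(N(θ) − 2R))²`, with a WALL at `R = N(θ)/2` (`= 15/2` at `θ = 3/20`:
the pole of an inverted close-packed lattice then fits inside the ball and clean charted chains zoom without bound).  The FAR RADIUS BUDGET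
of the line (lens-3 g38 memo; critic row 747 (2)) puts FAR's gross-free depth at `ρ_F ≈ 5–7` as the far-field engines are typed — i.e. AT
that wall.  But the assembly of parts H/I uses no-zoom only down to ONE site: the reachable site CLOSEST TO THE CENTRE of the core-centred ball.

§1 `CleanApproachHarnack θ R M₀ M₁` — part I's statement with one more hypothesis: `p` minimises the distance to the centre among the
   sites reachable from `x` by charted shell hops inside the ball.  WEAKER than `CleanBallHarnack` (hypothesis dropped).  Möbius lower
   bound now governed by the RADIUS: `M₀ ≥ (N(θ)/(N(θ) − R))²` = `1.56` (`R = 3`), `2.78` (`6`), `3.52` (`7`), `4` (`15/2`), `9` (`10`) at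
   `θ = 3/20`; wall moved to `R = N(θ) = 15` (centre at the pole).  So every FAR budget `ρ_F < 15` is served at `θ = 3/20` with a finite `M₀`.
§2 THE ASSEMBLY (proved, `θ ≤ 3/20`): `upgradeWitness_of_cleanApproachHarnack` — verbatim part I's, the Harnack hypothesis invoked once, at
   the minimiser; `chartedChargePricing_of_far_cleanApproachHarnack`: `FAR θ R ∧ CleanApproachHarnack θ R M₀ M₁ ∧ ChargeFreeCharted θ ⟹ P θ`.
   Literals: `(3/20, 3, 4, 80)` (of record, margin `1.56·qc` vs `4`) and, if FAR forces `R_c = 7`, `(3/20, 7, 6, 120)` ⇒ `UpgradeWitness (3/20) 7 120 14`.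
-/

noncomputable section

open Literature.MathematicalPhysics.StatisticalMechanics
open Literature.Geometry.DiscreteGeometry
open Summit.AtomisticToContinuum.Crystallization.Theses.PricedLinkCensus
open Summit.AtomisticToContinuum.Crystallization.Theorems.ChargedEnergyGapNegative
namespace Summit.AtomisticToContinuum.Crystallization.Theorems.ChargedEnergyGapChartDial

/-! ## §1 Clean-approach Harnack -/

/-- piece NOZOOM-APPROACH · residual of UPGRADE cut to the single instance the assembly uses · GEOMETRIC (no energy) · WEAKER than
`CleanBallHarnack θ R M₀ M₁` (`cleanApproachHarnack_of_cleanBallHarnack`) · immune to gross-bounded zooms (cleanness, as part I) AND to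
far-side zooms (the conclusion concerns only the reachable site nearest the centre) · QUANTITATIVE: Möbius needs `M₀ ≥ (15/(15 − R))²` at
`θ = 3/20` (`1.56` at `R = 3`, `3.52` at `R = 7`; wall `R = 15`) · TRUE-type expected at `(3/20, 3, 4, 80)` and `(3/20, 7, 6, 120)` ·
IDEA-NEEDED (quantitative discrete Liouville / quasiconformal stability of fully clean `θ`-charted regions) · INSTRUMENTABLE (census
I-ZOOM(c): clean charted clusters, zoom from a boundary site to the sites nearest the ball's centre).  Why it might fail: a clean non-Möbius
charted cluster whose scale at the centre of a ball of radius `R·nn x` through `x` is `< nn x / M₀`.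
**Clean-approach Harnack**: `x` charted, `x ∈ B̄(c, D)`, `D ≤ R·nn x`, the ball clean at scales `≥ nn x/M₁`; then for every site `p`
reachable from `x` by charted shell hops inside the ball AND nearest to `c` among all such sites, `nn x ≤ M₀·nn p`. -/
def CleanApproachHarnack (θ R M₀ M₁ : ℝ) : Prop :=
  ∀ (Q : PeriodicConfiguration 3) (x p : Q.points) (c : E3) (D : ℝ), ChartedAt θ Q x →
    dist (x : E3) c ≤ D → D ≤ R * nn Q x →
    (∀ q : Q.points, dist (q : E3) c ≤ D → nn Q x ≤ M₁ * nn Q q → ¬ ChartedAt θ Q q →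
      IsChargeFree (1 / 100) (Subtype.val : Q.points → E3) q) →
    Relation.ReflTransGen (fun a b : Q.points => ChartedHop θ Q a b ∧ dist (b : E3) c ≤ D) x p →
    (∀ q : Q.points, Relation.ReflTransGen (fun a b : Q.points => ChartedHop θ Q a b ∧ dist (b : E3) c ≤ D) x q →
      dist (p : E3) c ≤ dist (q : E3) c) →
    nn Q x ≤ M₀ * nn Q p

/-- Clean-ball Harnack implies clean-approach Harnack (the minimality hypothesis is simply dropped). -/
theorem cleanApproachHarnack_of_cleanBallHarnack {θ R M₀ M₁ : ℝ} (h : CleanBallHarnack θ R M₀ M₁) :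
    CleanApproachHarnack θ R M₀ M₁ :=
  fun Q x p c D hx hxc hD hclean hp _ => h Q x p c D hx hxc hD hclean hp

/-- … hence so do the chain forms of part H. -/
theorem cleanApproachHarnack_of_chainHarnackIn {θ R M₀ M₁ : ℝ} (h : ChainHarnackIn θ R M₀) : CleanApproachHarnack θ R M₀ M₁ :=
  cleanApproachHarnack_of_cleanBallHarnack (cleanBallHarnack_of_chainHarnackIn h)

/-- `CleanApproachHarnack` is monotone: smaller radius, larger `M₀`, larger `M₁` are weaker. -/
theorem cleanApproachHarnack_mono {θ R₀ R₁ M₀ M₀' M₁ M₁' : ℝ} (hR : R₁ ≤ R₀) (hM : M₀ ≤ M₀') (hM₁ : M₁ ≤ M₁')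
    (h : CleanApproachHarnack θ R₀ M₀ M₁) : CleanApproachHarnack θ R₁ M₀' M₁' := by
  intro Q x p c D hx hxc hD hclean hp hmin
  have hX : 0 < nn Q x := Blocks.nearestDist_pt_pos Q x
  have hP : 0 < nn Q p := Blocks.nearestDist_pt_pos Q p
  have h1 := h Q x p c D hx hxc (hD.trans (mul_le_mul_of_nonneg_right hR hX.le))
    (fun q hq hm hqc => hclean q hq
      (hm.trans (mul_le_mul_of_nonneg_right hM₁ (Blocks.nearestDist_pt_pos Q q).le)) hqc) hp hmin
  nlinarith only [h1, hM, hP]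

/-- The proved shell rung transfers. -/
theorem cleanApproachHarnack_shell {θ M₁ : ℝ} (hθ : θ ≤ 3 / 20) : CleanApproachHarnack θ (3 / 5) (4 / 3) M₁ :=
  cleanApproachHarnack_of_cleanBallHarnack (cleanBallHarnack_shell hθ)

/-! ## §2 The assembly: UPGRADE from clean-approach Harnack and the dictionary -/

section assembly

/-- **UPGRADE ⟸ NOZOOM-APPROACH ∧ DICTIONARY** (`θ ≤ 3/20`):
`CleanApproachHarnack θ R M₀ M₁ → ChargeFreeCharted θ → UpgradeWitness θ R (max M₁ (20·M₀)) (2R)`.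
Part I's proof with the Harnack hypothesis invoked once, at the reachable site nearest the core. -/
theorem upgradeWitness_of_cleanApproachHarnack {θ R M₀ M₁ : ℝ} (hθ : θ ≤ 3 / 20) (hM₀ : 0 ≤ M₀)
    (hH : CleanApproachHarnack θ R M₀ M₁) (hD : ChargeFreeCharted θ) :
    UpgradeWitness θ R (max M₁ (20 * M₀)) (2 * R) := by
  intro Q x _ hx hn
  obtain ⟨y, g, hg, hC, hU, hd⟩ := hn
  have hcX : 0 < nn Q (pt Q x) := Blocks.nearestDist_pt_pos Q _
  obtain ⟨z, hzv, hnnz, hzU⟩ : ∃ z : Q.points, (z : E3) = (y : E3) + g ∧ nn Q z = nn Q (pt Q y) ∧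
      ∀ p : Q.points, ChartedAt θ Q p → z ≠ p :=
    ⟨Blocks.transl Q hg (pt Q y), rfl, Blocks.nearestDist_transl Q hg (pt Q y),
      fun p hp => transl_ne_of_charted Q hU hg hp⟩
  obtain ⟨D₀, hD₀⟩ : ∃ D₀ : ℝ, dist ((pt Q x : Q.points) : E3) (z : E3) = D₀ := ⟨_, rfl⟩
  have hD₀R : D₀ ≤ R * nn Q (pt Q x) := by rw [← hD₀, hzv]; exact hd
  have hRn : 0 ≤ R * nn Q (pt Q x) := dist_nonneg.trans hd
  have h2R : ∀ {q : Q.points}, dist (q : E3) z ≤ D₀ → dist ((pt Q x : Q.points) : E3) q ≤ 2 * R * nn Q (pt Q x) := by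
    intro q hq
    calc dist ((pt Q x : Q.points) : E3) q
          ≤ dist ((pt Q x : Q.points) : E3) z + dist (z : E3) q := dist_triangle _ _ _
      _ ≤ D₀ + D₀ := add_le_add hD₀.le (by rw [dist_comm]; exact hq)
      _ ≤ 2 * R * nn Q (pt Q x) := by linarith
  by_cases hA : ∃ q : Q.points, dist (q : E3) z ≤ D₀ ∧ nn Q (pt Q x) ≤ M₁ * nn Q q ∧ ¬ ChartedAt θ Q q ∧
      ¬ IsChargeFree (1 / 100) (Subtype.val : Q.points → E3) q
  · obtain ⟨q, hqz, hqm, hqc, hqcharged⟩ := hA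
    have hq0 : 0 ≤ nn Q q := (Blocks.nearestDist_pt_pos Q q).le
    exact nearGrossCmp_of_uncharted_charged Q hqc hqcharged (h2R hqz)
      (hqm.trans (mul_le_mul_of_nonneg_right (le_max_left _ _) hq0))
  · push Not at hA
    have hclean : ∀ q : Q.points, dist (q : E3) z ≤ D₀ → nn Q (pt Q x) ≤ M₁ * nn Q q → ¬ ChartedAt θ Q q →
        IsChargeFree (1 / 100) (Subtype.val : Q.points → E3) q :=
      fun q hq hm hqc => hA q hq hm hqc
    let rel : Q.points → Q.points → Prop := fun a b => ChartedHop θ Q a b ∧ dist (b : E3) z ≤ D₀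
    have hfacts : ∀ p : Q.points, Relation.ReflTransGen rel (pt Q x) p → ChartedAt θ Q p ∧ dist (p : E3) z ≤ D₀ := by
      intro p hp
      rcases hp.cases_tail with rfl | ⟨c, -, hcp⟩
      · exact ⟨hx, hD₀.le⟩
      · exact ⟨hcp.1.2.1, hcp.2⟩
    have hfin : (Metric.closedBall (z : E3) D₀ ∩ Q.points).Finite := Q.finite_inter_points Metric.isBounded_closedBall
    have hSfin : {p : Q.points | Relation.ReflTransGen rel (pt Q x) p}.Finite := by
      refine (hfin.preimage Subtype.val_injective.injOn).subset fun p hp => ?_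
      exact ⟨Metric.mem_closedBall.2 (hfacts p hp).2, p.2⟩
    obtain ⟨p, hpF, hmin⟩ := hSfin.toFinset.exists_min_image (fun p : Q.points => dist (p : E3) z)
      ⟨pt Q x, hSfin.mem_toFinset.2 Relation.ReflTransGen.refl⟩
    have hpS : Relation.ReflTransGen rel (pt Q x) p := hSfin.mem_toFinset.1 hpF
    obtain ⟨hpc, hpz⟩ := hfacts p hpS
    have hcp : 0 < nn Q p := Blocks.nearestDist_pt_pos Q p
    -- the ONE use of the Harnack hypothesis: at the reachable site nearest the core
    have hXp : nn Q (pt Q x) ≤ M₀ * nn Q p :=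
      hH Q (pt Q x) p (z : E3) D₀ hx hD₀.le hD₀R hclean hpS (fun q hq => hmin q (hSfin.mem_toFinset.2 hq))
    have h20 : ∀ {s : ℝ}, (1 / 5 - θ) * nn Q p ≤ s → nn Q p ≤ 20 * s := by
      intro s hs
      have h3 : 1 / 20 * nn Q p ≤ (1 / 5 - θ) * nn Q p := mul_le_mul_of_nonneg_right (by linarith) hcp.le
      linarith
    have hmax : ∀ {s : ℝ}, 0 ≤ s → nn Q p ≤ 20 * s → nn Q (pt Q x) ≤ max M₁ (20 * M₀) * s := by
      intro s hs hps
      calc nn Q (pt Q x) ≤ M₀ * nn Q p := hXp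
        _ ≤ M₀ * (20 * s) := mul_le_mul_of_nonneg_left hps hM₀
        _ = 20 * M₀ * s := by ring
        _ ≤ max M₁ (20 * M₀) * s := mul_le_mul_of_nonneg_right (le_max_right _ _) hs
    by_cases hin : dist (p : E3) z ≤ 6 / 5 * nn Q p
    · have hmargin := nn_shell_ge Q (by linarith) hpc (hzU p hpc) hin
      rw [hnnz] at hmargin
      exact ⟨y, g, hg, hC, hU, hd.trans (by linarith only [hRn]),
        hmax (Blocks.nearestDist_pt_pos Q _).le (h20 hmargin)⟩
    · push Not at hin
      obtain ⟨q, hqp, hqd, hqz⟩ := exists_shell_point_closer Q hθ hpc hin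
      by_cases hqc : ChartedAt θ Q q
      · have hqS : Relation.ReflTransGen rel (pt Q x) q := hpS.tail ⟨⟨hpc, hqc, hqp, hqd⟩, hqz.le.trans hpz⟩
        exact absurd (hmin q (hSfin.mem_toFinset.2 hqS)) (not_le.2 hqz)
      · have hqcharged : ¬ IsChargeFree (1 / 100) (Subtype.val : Q.points → E3) q := fun h => hqc (hD Q q h)
        have hmargin := nn_shell_ge Q (by linarith) hpc hqp hqd
        exact nearGrossCmp_of_uncharted_charged Q hqc hqcharged (h2R (hqz.le.trans hpz))
          (hmax (Blocks.nearestDist_pt_pos Q q).le (h20 hmargin))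

/-- COLLAR from clean-approach Harnack and the dictionary. -/
theorem collarPricing_of_cleanApproachHarnack {θ R M₀ M₁ : ℝ} (hθ : θ ≤ 3 / 20) (hR : 0 < R) (hM₀ : 0 ≤ M₀)
    (hH : CleanApproachHarnack θ R M₀ M₁) (hD : ChargeFreeCharted θ) : CollarPricing θ R :=
  collarPricing_of_upgrade (by positivity) ((mul_nonneg (by norm_num) hM₀).trans (le_max_right _ _))
    (upgradeWitness_of_cleanApproachHarnack hθ hM₀ hH hD)

/-- **The line beneath P after part J**: `FAR θ R ∧ NOZOOM-APPROACH θ R M₀ M₁ ∧ DICTIONARY θ ⟹ ChartedChargePricing θ`. -/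
theorem chartedChargePricing_of_far_cleanApproachHarnack {θ R M₀ M₁ : ℝ} (hθ : θ ≤ 3 / 20) (hR : 0 < R) (hM₀ : 0 ≤ M₀)
    (hF : FarFieldPricing θ R) (hH : CleanApproachHarnack θ R M₀ M₁) (hD : ChargeFreeCharted θ) :
    ChartedChargePricing θ :=
  chartedChargePricing_of_far_collar hF (collarPricing_of_cleanApproachHarnack hθ hR hM₀ hH hD)

end assembly

end Summit.AtomisticToContinuum.Crystallization.Theorems.ChargedEnergyGapChartDial

end
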